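import Literature.AlgebraicGeometry.Hu2025.Statements.S01S09Interface.R110cUniversalityInterface
import Literature.AlgebraicGeometry.Hu2025.Proofs.S01S09Interface.Prop91OursCorank
import Mathlib.LinearAlgebra.FiniteDimensional.Lemmas
import HarnessLib

/-!
# `Prop9_1_ours_holds` — [Hu25] Proposition 9.1 (= Lafforgue, *Chirurgie des grassmanniennes*, Prop. p.4, via [Hu25] §9)
# READ AT FIELD-VALUED POINTS over the OCCURRING strata HOLDS as typed (row 110 file c, `S01S09Interface.Prop9_1_ours`).
# res-type-024 gen 11. Kernel support for OUR typed reading; nothing of [Hu25]/[La03] asserted; [La03] primary unread (acq-07745).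

Statement proved: for every family `d = (d_I)` with the three printed properties that is REALISED by some `d`-plane
`F₀ ≤ K₀^n` (`HuMatroid.IsRealisable`), for every field `K` and every `d`-plane `F ≤ K^n`:
`(∀ I, dim_K(F ∩ E_I) = d_I) ↔ (∀ u, |u| = d → (p_u(F) ≠ 0 ↔ x_u ∈ Δ^{d,n}_d))` — i.e. `Prop9_1 d` under the binder.
Route (OURS, elementary — [Hu25] prints no proof, [La03] is not held): `δ_F : I ↦ dim(F ∩ E_I)` is a corank function
(`Prop91OursCorank` `IsCorank`: monotone, unit increase by rank–nullity on one coordinate, supermodular by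
`dim(A + B) + dim(A ∩ B) = dim A + dim B`); `p_u(F) ≠ 0 ↔ δ_F([n] ∖ u) = 0` (the coordinate projection `F → K^u` is
bijective iff injective iff `F ∩ E_{[n]∖u} = 0`); `x_u ∈ Δ_d ↔ d_{[n]∖u} = 0`; and a corank function is determined by its
bases (`IsCorank.eq_of_bases`). So both sides say «`F` and `F₀` have the same bases», and the left side says «the same
corank function». Companion: `Prop91LiteralEmptyCell.lean` (the LITERAL reading `Prop9_1` fails for a non-realisable
family with the printed properties). AI proving is weaker than expert review; the adjudication (HU-R01) reads the typed decls.
-/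
namespace Literature.AlgebraicGeometry.Hu2025.Statements.S01S09Interface

namespace Prop9_1Ours

open Module

section LA

variable {K : Type} [Field K] {n d : ℕ}

/-- `δ_F(I) = dim_K(F ∩ E_I)`.
[cite: Hu2025, §9 / Proposition 9.1 chunk p0072 l.24–34, l.71–82 (unrefereed preprint arXiv:2507.21400v1 under adjudication, D-0012/D-0089 — kernel support on OUR typed carriers of row 110; nothing of the source asserted; [La03] primary unread)] -/
noncomputable def corank (F : Submodule K (Fin n → K)) (I : Finset (Fin n)) : ℕ :=
  finrank K ↥(F ⊓ coordSubspace K I)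

/-- Membership in `E_I` (`coordSubspace K I`): `v ∈ E_I ↔ v` vanishes off `I`.
[cite: Hu2025, §9 / Proposition 9.1 chunk p0072 l.24–34, l.71–82 (unrefereed preprint arXiv:2507.21400v1 under adjudication, D-0012/D-0089 — kernel support on OUR typed carriers of row 110; nothing of the source asserted; [La03] primary unread)] -/
theorem mem_coordSubspace {I : Finset (Fin n)} {v : Fin n → K} :
    v ∈ coordSubspace K I ↔ ∀ i, i ∉ I → v i = 0 := by
  simp [coordSubspace, Submodule.mem_pi]

/-- `I ⊆ J → E_I ≤ E_J`.
[cite: Hu2025, §9 / Proposition 9.1 chunk p0072 l.24–34, l.71–82 (unrefereed preprint arXiv:2507.21400v1 under adjudication, D-0012/D-0089 — kernel support on OUR typed carriers of row 110; nothing of the source asserted; [La03] primary unread)] -/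
theorem coordSubspace_mono {I J : Finset (Fin n)} (h : I ⊆ J) : coordSubspace K I ≤ coordSubspace K J := by
  intro v hv
  rw [mem_coordSubspace] at hv ⊢
  exact fun i hi => hv i fun hi' => hi (h hi')

/-- `E_∅ = 0`.
[cite: Hu2025, §9 / Proposition 9.1 chunk p0072 l.24–34, l.71–82 (unrefereed preprint arXiv:2507.21400v1 under adjudication, D-0012/D-0089 — kernel support on OUR typed carriers of row 110; nothing of the source asserted; [La03] primary unread)] -/
theorem coordSubspace_empty : coordSubspace K (∅ : Finset (Fin n)) = ⊥ := by
  rw [eq_bot_iff]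
  intro v hv
  rw [mem_coordSubspace] at hv
  rw [Submodule.mem_bot]
  funext i
  exact hv i (by simp)

/-- `E_[n] = K^n`.
[cite: Hu2025, §9 / Proposition 9.1 chunk p0072 l.24–34, l.71–82 (unrefereed preprint arXiv:2507.21400v1 under adjudication, D-0012/D-0089 — kernel support on OUR typed carriers of row 110; nothing of the source asserted; [La03] primary unread)] -/
theorem coordSubspace_univ : coordSubspace K (Finset.univ : Finset (Fin n)) = ⊤ := by
  rw [eq_top_iff]
  intro v _
  rw [mem_coordSubspace]
  intro i hi
  exact absurd (Finset.mem_univ i) hi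

/-- `E_I ∩ E_J = E_{I ∩ J}`.
[cite: Hu2025, §9 / Proposition 9.1 chunk p0072 l.24–34, l.71–82 (unrefereed preprint arXiv:2507.21400v1 under adjudication, D-0012/D-0089 — kernel support on OUR typed carriers of row 110; nothing of the source asserted; [La03] primary unread)] -/
theorem coordSubspace_inf (I J : Finset (Fin n)) :
    coordSubspace K I ⊓ coordSubspace K J = coordSubspace K (I ∩ J) := by
  ext v
  simp only [Submodule.mem_inf, mem_coordSubspace, Finset.mem_inter, not_and_or]
  constructor
  · rintro ⟨h1, h2⟩ i (hi | hi)
    · exact h1 i hi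
    · exact h2 i hi
  · intro h
    exact ⟨fun i hi => h i (Or.inl hi), fun i hi => h i (Or.inr hi)⟩

/-- `δ_F` is monotone: `I ⊆ J → dim(F ∩ E_I) ≤ dim(F ∩ E_J)`.
[cite: Hu2025, §9 / Proposition 9.1 chunk p0072 l.24–34, l.71–82 (unrefereed preprint arXiv:2507.21400v1 under adjudication, D-0012/D-0089 — kernel support on OUR typed carriers of row 110; nothing of the source asserted; [La03] primary unread)] -/
theorem corank_mono (F : Submodule K (Fin n → K)) {I J : Finset (Fin n)} (h : I ⊆ J) :
    corank F I ≤ corank F J :=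
  Submodule.finrank_mono (inf_le_inf_left F (coordSubspace_mono h))

/-- Unit increase: `dim(F ∩ E_{I ∪ {i}}) ≤ dim(F ∩ E_I) + 1` (rank–nullity for the `i`-th coordinate on `F ∩ E_{I ∪ {i}}`, whose kernel lies in `F ∩ E_I`).
[cite: Hu2025, §9 / Proposition 9.1 chunk p0072 l.24–34, l.71–82 (unrefereed preprint arXiv:2507.21400v1 under adjudication, D-0012/D-0089 — kernel support on OUR typed carriers of row 110; nothing of the source asserted; [La03] primary unread)] -/
theorem corank_insert_le (F : Submodule K (Fin n → K)) (i : Fin n) (I : Finset (Fin n)) :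
    corank F (insert i I) ≤ corank F I + 1 := by
  let A : Submodule K (Fin n → K) := F ⊓ coordSubspace K (insert i I)
  let φ : A →ₗ[K] K := (LinearMap.proj i).comp A.subtype
  have h1 := LinearMap.finrank_range_add_finrank_ker φ
  have h2 : finrank K (LinearMap.range φ) ≤ 1 := by
    calc finrank K (LinearMap.range φ) ≤ finrank K K := Submodule.finrank_le _
      _ = 1 := Module.finrank_self K
  have h3 : finrank K (LinearMap.ker φ) ≤ corank F I := by
    rw [← Submodule.finrank_map_subtype_eq A (LinearMap.ker φ)]
    apply Submodule.finrank_mono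
    rintro v ⟨w, hw, rfl⟩
    have hwA : (w : Fin n → K) ∈ F ⊓ coordSubspace K (insert i I) := w.2
    rw [Submodule.mem_inf, mem_coordSubspace] at hwA
    refine Submodule.mem_inf.mpr ⟨hwA.1, ?_⟩
    rw [mem_coordSubspace]
    intro j hj
    by_cases hji : j = i
    · subst hji
      simpa [φ] using hw
    · exact hwA.2 j (by simp [hji, hj])
  show finrank K A ≤ corank F I + 1
  omega

/-- Supermodularity: `dim(F ∩ E_I) + dim(F ∩ E_J) ≤ dim(F ∩ E_{I∪J}) + dim(F ∩ E_{I∩J})` (`dim(A+B) + dim(A ∩ B) = dim A + dim B` with `A ∩ B = F ∩ E_{I∩J}`, `A + B ≤ F ∩ E_{I∪J}`) — the printed bullet of [Hu25] §9 l.32, here PROVED for `δ_F`.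
[cite: Hu2025, §9 / Proposition 9.1 chunk p0072 l.24–34, l.71–82 (unrefereed preprint arXiv:2507.21400v1 under adjudication, D-0012/D-0089 — kernel support on OUR typed carriers of row 110; nothing of the source asserted; [La03] primary unread)] -/
theorem corank_supermod (F : Submodule K (Fin n → K)) (I J : Finset (Fin n)) :
    corank F I + corank F J ≤ corank F (I ∪ J) + corank F (I ∩ J) := by
  have h := Submodule.finrank_sup_add_finrank_inf_eq (F ⊓ coordSubspace K I) (F ⊓ coordSubspace K J)
  have hinf : (F ⊓ coordSubspace K I) ⊓ (F ⊓ coordSubspace K J) = F ⊓ coordSubspace K (I ∩ J) := by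
    rw [← coordSubspace_inf]; exact (inf_inf_distrib_left F _ _).symm
  have hsup : (F ⊓ coordSubspace K I) ⊔ (F ⊓ coordSubspace K J) ≤ F ⊓ coordSubspace K (I ∪ J) :=
    sup_le (inf_le_inf_left F (coordSubspace_mono Finset.subset_union_left))
      (inf_le_inf_left F (coordSubspace_mono Finset.subset_union_right))
  have h2 := Submodule.finrank_mono hsup
  rw [hinf] at h
  unfold corank
  omega

/-- `δ_F` is a corank function when `dim F = d`.
[cite: Hu2025, §9 / Proposition 9.1 chunk p0072 l.24–34, l.71–82 (unrefereed preprint arXiv:2507.21400v1 under adjudication, D-0012/D-0089 — kernel support on OUR typed carriers of row 110; nothing of the source asserted; [La03] primary unread)] -/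
theorem isCorank_corank (F : Submodule K (Fin n → K)) (hF : finrank K F = d) : IsCorank n d (corank F) where
  empty := by rw [corank, coordSubspace_empty, inf_bot_eq]; exact finrank_bot K _
  univ := by rw [corank, coordSubspace_univ, inf_top_eq]; exact hF
  mono _ _ h := corank_mono F h
  insert_le := corank_insert_le F
  supermod := corank_supermod F

/-- bridge: `p_u(F) ≠ 0 ↔ dim(F ∩ E_{[n]∖u}) = 0` when `dim F = |u|`.
[cite: Hu2025, §9 / Proposition 9.1 chunk p0072 l.24–34, l.71–82 (unrefereed preprint arXiv:2507.21400v1 under adjudication, D-0012/D-0089 — kernel support on OUR typed carriers of row 110; nothing of the source asserted; [La03] primary unread)] -/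
theorem plueckerNonzero_iff (F : Submodule K (Fin n → K)) {u : Finset (Fin n)} (hF : finrank K F = u.card) :
    PlueckerNonzero K F u ↔ corank F uᶜ = 0 := by
  let L : F →ₗ[K] (↥u → K) := (LinearMap.funLeft K K ((↑) : ↥u → Fin n)).comp F.subtype
  have hL : (fun v : F => fun i : ↥u => (v : Fin n → K) i) = L := rfl
  have hdim : finrank K F = finrank K (↥u → K) := by
    rw [hF, Module.finrank_fintype_fun_eq_card, Fintype.card_coe]
  unfold PlueckerNonzero
  rw [hL, corank, Submodule.finrank_eq_zero]
  constructor
  · intro hbij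
    rw [eq_bot_iff]
    intro v hv
    rw [Submodule.mem_inf, mem_coordSubspace] at hv
    have : L ⟨v, hv.1⟩ = 0 := by
      funext i
      exact hv.2 i (by simp)
    have h0 := hbij.1 (this.trans (map_zero L).symm)
    rw [Submodule.mem_bot]
    exact congr_arg Subtype.val h0
  · intro hbot
    have hinj : Function.Injective L := by
      rw [injective_iff_map_eq_zero]
      intro v hv
      have hmem : (v : Fin n → K) ∈ F ⊓ coordSubspace K uᶜ := by
        refine Submodule.mem_inf.mpr ⟨v.2, ?_⟩
        rw [mem_coordSubspace]
        intro i hi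
        rw [Finset.mem_compl, not_not] at hi
        exact congr_fun hv ⟨i, hi⟩
      rw [hbot, Submodule.mem_bot] at hmem
      exact Subtype.ext hmem
    exact ⟨hinj, (LinearMap.injective_iff_surjective_of_finrank_eq_finrank hdim).1 hinj⟩

end LA

end Prop9_1Ours

open Prop9_1Ours in
/-- **`Prop9_1_ours` HOLDS as typed** — Lafforgue's Proposition (p.4 of [La03] via [Hu25] Prop. 9.1) READ AT FIELD-VALUED
POINTS, for every family `d` indexing an OCCURRING stratum: for every field `K` and `d`-plane `F ≤ K^n`,
`(∀ I, dim(F ∩ E_I) = d_I) ↔ (∀ |u| = d, p_u(F) ≠ 0 ↔ x_u ∈ Δ_d)`. Route (OURS, elementary): `I ↦ dim(F ∩ E_I)` is a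
«corank function» (monotone, unit increase, supermodular, `∅ ↦ 0`, `[n] ↦ d`); `x_u ∈ Δ_d ↔ d_{[n]∖u} = 0` (vertices =
bases); a corank function is determined by its bases (independent spanning subsets exist and extend to bases, by
supermodularity); `p_u(F) ≠ 0 ↔ dim(F ∩ E_{[n]∖u}) = 0` (rank–nullity).
[cite: Hu2025, Proposition 9.1 chunk p0072 l.71–82 with l.24–28 (unrefereed preprint arXiv:2507.21400v1 under adjudication,
D-0012/D-0089 — kernel proof of OUR typed reading `Prop9_1_ours`; nothing of the source asserted; [La03] primary unread)]
[cite: Hu2025, §9 / Proposition 9.1 chunk p0072 l.24–34, l.71–82 (unrefereed preprint arXiv:2507.21400v1 under adjudication, D-0012/D-0089 — kernel support on OUR typed carriers of row 110; nothing of the source asserted; [La03] primary unread)] -/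
theorem Prop9_1_ours_holds {n d : ℕ} (M : HuMatroid n d) : Prop9_1_ours M := by
  rintro ⟨K₀, _instK₀, F₀, hF₀d, hF₀⟩ K _instK F hF
  have hM : M.dI = corank F₀ := funext fun I => (hF₀ I).symm
  have hc₀ : IsCorank n d M.dI := by rw [hM]; exact isCorank_corank F₀ hF₀d
  have hcF : IsCorank n d (corank F) := isCorank_corank F hF
  have hV : ∀ u : Finset (Fin n), u.card = d → (VertexMem M u ↔ M.dI uᶜ = 0) := by
    intro u hu
    show (u.card = d ∧ ∀ I, M.dI I ≤ (u ∩ I).card) ↔ M.dI uᶜ = 0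
    rw [hc₀.forall_le_card_inter_iff u]
    exact ⟨fun h => h.2, fun h => ⟨hu, h⟩⟩
  constructor
  · rintro ⟨-, hI⟩ u hu
    rw [plueckerNonzero_iff F (hF.trans hu.symm), hV u hu, ← hI uᶜ]
    rfl
  · intro hR
    refine ⟨hF, fun I => ?_⟩
    have hB : ∀ u : Finset (Fin n), u.card = d → (corank F uᶜ = 0 ↔ M.dI uᶜ = 0) := by
      intro u hu
      rw [← plueckerNonzero_iff F (hF.trans hu.symm), ← hV u hu]
      exact hR u hu
    exact congr_fun (hcF.eq_of_bases hc₀ hB) I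

/-- Hence the literal `Prop9_1 d` holds for every family `d` that indexes an occurring stratum (and, by
`not_prop9_1_laneAFamily`, not for every family with the three printed properties).
[cite: Hu2025, Proposition 9.1 chunk p0072 l.71–82 (unrefereed preprint under adjudication — kernel support on OUR typed
readings; nothing of the source asserted)]
[cite: Hu2025, §9 / Proposition 9.1 chunk p0072 l.24–34, l.71–82 (unrefereed preprint arXiv:2507.21400v1 under adjudication, D-0012/D-0089 — kernel support on OUR typed carriers of row 110; nothing of the source asserted; [La03] primary unread)] -/
theorem prop9_1_of_isRealisable {n d : ℕ} (M : HuMatroid n d) (h : M.IsRealisable) : Prop9_1 M :=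
  Prop9_1_ours_holds M h

open Prop9_1Ours in
/-- **An occurring stratum has a vertex**: if `d` is realised (`HuMatroid.IsRealisable`), some `d`-subset `m` has
`x_m ∈ Δ^{d,n}_d` (`VertexMem d m`) — the realisable case of [Hu25]'s «Since `Δ_d ≠ ∅`, there exists `m` such that
`x_m ∈ Δ_d`» (chunk p0072 l.128–130; file e `C72L129` types the printed real-polytope form, not proved here). Route: the
empty set is independent for the corank function `d` and extends to a basis (`IsCorank.exists_base_superset`).
[cite: Hu2025, §9 chunk p0072 l.128–130 with l.24–28 (unrefereed preprint arXiv:2507.21400v1 under adjudication, D-0012/D-0089 — kernel support on OUR typed carriers of row 110; nothing of the source asserted)] -/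
theorem exists_vertexMem_of_isRealisable {n d : ℕ} (M : HuMatroid n d) (h : M.IsRealisable) :
    ∃ m : Finset (Fin n), VertexMem M m := by
  obtain ⟨K₀, _instK₀, F₀, hF₀d, hF₀⟩ := h
  have hM : M.dI = corank F₀ := funext fun I => (hF₀ I).symm
  have hc₀ : IsCorank n d M.dI := by rw [hM]; exact isCorank_corank F₀ hF₀d
  obtain ⟨u, -, hud, hu0⟩ := hc₀.exists_base_superset _ ∅ rfl (by simp [hc₀.univ])
  exact ⟨u, hud, (hc₀.forall_le_card_inter_iff u).2 hu0⟩

end Literature.AlgebraicGeometry.Hu2025.Statements.S01S09Interface
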